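import Mathlib.Analysis.Complex.RemovableSingularity
import Mathlib.Analysis.Complex.RealDeriv
import Mathlib.Analysis.Complex.ReImTopology
import Mathlib.Analysis.InnerProductSpace.Calculus
import Mathlib.Analysis.InnerProductSpace.Harmonic.Constructions
import Mathlib.Analysis.SpecialFunctions.Log.Deriv
import Literature.Analysis.Complex.InjectiveHolomorphic
import HarnessLib

/-!
# The Green function of a planar domain through a conformal map onto the half-plane

Topic `Literature/Probability/RandomPlanarGeometry` (potential theory of simply connected planar
domains; continuum input of the discharge of
`Literature.Probability.LatticeModels.Kenyon2000_flatEdgePoissonKernelLimit`, Kenyon 2000,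
§5.3–§6: the Green function `g(v₁, v₂) = -(1/2π) log|v₁ - v₂| + …` of `U` and its normal
derivative on a flat edge through the Riemann map).

Let `Ω ⊆ ℂ` be open and `w` holomorphic and injective on `Ω` with `w(Ω) = ℍ = {im > 0}`; put
`b = w u` for `u ∈ Ω`. The Green function of `Ω` with pole `u` is
`g(z) = (2π)⁻¹ log (‖w z - conj b‖ / ‖w z - b‖)` (pull-back of the Green function of `ℍ`).
PROVED here:

* `normSq_sub_conj_sub` — `‖ζ - conj b‖² - ‖ζ - b‖² = 4 im ζ · im b`;
* `isCompact_greenLevelSet`, `greenLevelSet_subset` — `{ζ | ‖ζ - b‖ ≤ c ‖ζ - conj b‖}` is a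
  compact subset of `ℍ` for `0 ≤ c < 1`;
* `continuousOn_invFunOn_of_bijOn` — the inverse of `w` is continuous on `ℍ` (open mapping for
  injective holomorphic maps, `SCV.isOpen_image_of_injOn`);
* **`exists_isCompact_green_lt`** — `g → 0` at the ideal boundary of `Ω`: for `ε > 0` there is
  a compact `K ⊆ Ω` off which `g < ε`;
* **`harmonicOnNhd_greenPotential`**, `greenPotential_eq` — the function
  `f(z) = (2π)⁻¹ log ‖(w z - conj b) / dslope w u z‖` is harmonic on `Ω` and equals
  `g(z) + (2π)⁻¹ log ‖z - u‖` for `z ≠ u` (removable singularity at the pole);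
* **`im_eq_zero_of_mem_frontier`** — if `w` is holomorphic on an open `U ⊇ Ω`, then `w` is real
  at every point of `frontier Ω ∩ U`;
* `im_deriv_eq_zero_of_real_on_segment` — if `w (x + t)` is real for small real `t`, then
  `deriv w x` is real;
* **`hasDerivAt_green_normal`**, **`tendsto_green_div`** — at such a point `x` (with `w x`,
  `deriv w x` real, `im b > 0`), `s ↦ g(x + i s)` has derivative
  `π⁻¹ · im b · re (deriv w x) / ‖b - w x‖²` at `s = 0`, whence the normal derivative limit
  `g(x + i s)/s → π⁻¹ im b re(w'(x)) / ‖b - w x‖²`.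

Everything is proved, [folklore] (classical potential theory; Kenyon 2000, §6.1 for the role of
the formulas); no named fact.

## References

* R. Kenyon, *Conformal invariance of domino tiling*, Ann. Probab. 28 (2000), §5.3, §6.1
  [Kenyon2000].
* L. V. Ahlfors, *Complex Analysis*, 3rd ed. (1979), Ch. 4 §3.3 and Ch. 6 §5 [AhlforsCA1979].
-/

noncomputable section

namespace Literature.Probability.RandomPlanarGeometry

open Set Metric Complex Filter _root_.Topology ComplexConjugate InnerProductSpace

/-! ### The Green function of the upper half-plane -/

/-- `‖ζ - conj b‖² - ‖ζ - b‖² = 4 im ζ im b`. [folklore] -/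
theorem normSq_sub_conj_sub (ζ b : ℂ) :
    normSq (ζ - conj b) - normSq (ζ - b) = 4 * ζ.im * b.im := by
  simp only [normSq_apply, sub_re, sub_im, conj_re, conj_im]
  ring

/-- For `im b > 0` and `0 ≤ c < 1` the sublevel set `{ζ | ‖ζ - b‖ ≤ c ‖ζ - conj b‖}` of the
Green function of `ℍ` with pole `b` lies in `ℍ`. [folklore] -/
theorem greenLevelSet_subset {b : ℂ} (hb : 0 < b.im) {c : ℝ} (hc1 : c < 1) :
    {ζ : ℂ | ‖ζ - b‖ ≤ c * ‖ζ - conj b‖} ⊆ {ζ : ℂ | 0 < ζ.im} := by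
  intro ζ hζ
  by_contra him
  have him' : ζ.im ≤ 0 := le_of_not_gt him
  have h1 : normSq (ζ - conj b) ≤ normSq (ζ - b) := by
    have := normSq_sub_conj_sub ζ b
    nlinarith
  have h2 : ‖ζ - conj b‖ ≤ ‖ζ - b‖ :=
    (pow_le_pow_iff_left₀ (norm_nonneg _) (norm_nonneg _) two_ne_zero).1
      (by rwa [← normSq_eq_norm_sq, ← normSq_eq_norm_sq])
  have h4 : ‖ζ - b‖ = 0 := by
    have hζ' : ‖ζ - b‖ ≤ c * ‖ζ - conj b‖ := hζ
    rcases le_or_gt c 0 with hc0 | hc0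
    · have : c * ‖ζ - conj b‖ ≤ 0 := mul_nonpos_of_nonpos_of_nonneg hc0 (norm_nonneg _)
      linarith [norm_nonneg (ζ - b)]
    · have : c * ‖ζ - conj b‖ ≤ c * ‖ζ - b‖ := mul_le_mul_of_nonneg_left h2 hc0.le
      nlinarith [norm_nonneg (ζ - b)]
  rw [norm_eq_zero, sub_eq_zero] at h4
  rw [h4] at him'
  linarith

/-- The sublevel set `{ζ | ‖ζ - b‖ ≤ c ‖ζ - conj b‖}` (`0 ≤ c < 1`) is compact (closed, and
bounded: `‖ζ - b‖ ≤ c ‖b - conj b‖ / (1 - c)`). [folklore] -/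
theorem isCompact_greenLevelSet (b : ℂ) {c : ℝ} (hc0 : 0 ≤ c) (hc1 : c < 1) :
    IsCompact {ζ : ℂ | ‖ζ - b‖ ≤ c * ‖ζ - conj b‖} := by
  refine Metric.isCompact_of_isClosed_isBounded ?_ ?_
  · exact isClosed_le (continuous_id.sub continuous_const).norm
      (continuous_const.mul (continuous_id.sub continuous_const).norm)
  · refine (isBounded_iff_subset_closedBall b).2 ⟨c * ‖b - conj b‖ / (1 - c), fun ζ hζ => ?_⟩
    rw [mem_closedBall, dist_eq_norm]
    have h1 : ‖ζ - conj b‖ ≤ ‖ζ - b‖ + ‖b - conj b‖ := by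
      simpa [sub_add_sub_cancel] using norm_add_le (ζ - b) (b - conj b)
    rw [le_div_iff₀ (by linarith)]
    have h2 : c * ‖ζ - conj b‖ ≤ c * (‖ζ - b‖ + ‖b - conj b‖) := mul_le_mul_of_nonneg_left h1 hc0
    have h3 : ‖ζ - b‖ ≤ c * ‖ζ - conj b‖ := hζ
    have h4 : ‖ζ - b‖ * (1 - c) = ‖ζ - b‖ - c * ‖ζ - b‖ := by ring
    rw [h4]
    linarith

/-! ### The inverse conformal map is continuous; `g → 0` at the boundary -/

/-- The inverse of an injective holomorphic map `w : Ω → V` (`Ω` open, `w(Ω) = V`) is continuous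
on `V` (open mapping theorem for injective holomorphic maps). [folklore] -/
theorem continuousOn_invFunOn_of_bijOn {Ω V : Set ℂ} (hΩ : IsOpen Ω) {w : ℂ → ℂ}
    (hw : DifferentiableOn ℂ w Ω) (hbij : BijOn w Ω V) :
    ContinuousOn (Function.invFunOn w Ω) V := by
  have hV : IsOpen V := by
    rw [← hbij.image_eq]
    exact Literature.Analysis.Complex.SCV.isOpen_image_of_injOn rfl hw hΩ hbij.injOn
  rw [continuousOn_open_iff hV]
  intro t ht
  have heq : V ∩ Function.invFunOn w Ω ⁻¹' t = w '' (Ω ∩ t) := by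
    ext ζ
    constructor
    · rintro ⟨hζV, hζt⟩
      have hζ' : ζ ∈ w '' Ω := hbij.image_eq.symm ▸ hζV
      exact ⟨Function.invFunOn w Ω ζ, ⟨Function.invFunOn_mem hζ', hζt⟩, Function.invFunOn_eq hζ'⟩
    · rintro ⟨z, ⟨hzΩ, hzt⟩, rfl⟩
      refine ⟨hbij.mapsTo hzΩ, ?_⟩
      show Function.invFunOn w Ω (w z) ∈ t
      rw [hbij.injOn.leftInvOn_invFunOn hzΩ]
      exact hzt
  rw [heq]
  exact Literature.Analysis.Complex.SCV.isOpen_image_of_injOn rfl (hw.mono inter_subset_left)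
    (hΩ.inter ht) (hbij.injOn.mono inter_subset_left)

/-- **The Green function tends to zero at the boundary.** Let `w` be holomorphic and injective on
the open set `Ω` with `w(Ω) = ℍ`, `u ∈ Ω`, `b = w u`. For every `ε > 0` there is a compact set
`K ⊆ Ω` such that `(2π)⁻¹ log (‖w z - conj b‖/‖w z - b‖) < ε` for all `z ∈ Ω ∖ K` (the sublevel
sets of the Green function of `ℍ` are compact in `ℍ`, and the inverse map is continuous).
[folklore] -/
theorem exists_isCompact_green_lt {Ω : Set ℂ} (hΩ : IsOpen Ω) {w : ℂ → ℂ}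
    (hw : DifferentiableOn ℂ w Ω) (hbij : BijOn w Ω {z : ℂ | 0 < z.im}) {u : ℂ} (hu : u ∈ Ω)
    {ε : ℝ} (hε : 0 < ε) :
    ∃ K : Set ℂ, IsCompact K ∧ K ⊆ Ω ∧ ∀ z ∈ Ω, z ∉ K →
      (2 * Real.pi)⁻¹ * Real.log (‖w z - conj (w u)‖ / ‖w z - w u‖) < ε := by
  set b := w u with hb
  have hbim : 0 < b.im := hbij.mapsTo hu
  set c : ℝ := Real.exp (-(2 * Real.pi * ε)) with hc
  have hc0 : 0 < c := Real.exp_pos _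
  have hc1 : c < 1 := by
    have : Real.exp (-(2 * Real.pi * ε)) < Real.exp 0 :=
      Real.exp_lt_exp.2 (neg_lt_zero.2 (by positivity))
    rwa [Real.exp_zero] at this
  set C : Set ℂ := {ζ : ℂ | ‖ζ - b‖ ≤ c * ‖ζ - conj b‖} with hC
  have hCc : IsCompact C := isCompact_greenLevelSet b hc0.le hc1
  have hCH : C ⊆ {z : ℂ | 0 < z.im} := greenLevelSet_subset hbim hc1
  set v := Function.invFunOn w Ω with hv
  have hvc : ContinuousOn v C := (continuousOn_invFunOn_of_bijOn hΩ hw hbij).mono hCH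
  refine ⟨v '' C, hCc.image_of_continuousOn hvc, ?_, ?_⟩
  · rintro _ ⟨ζ, hζ, rfl⟩
    exact Function.invFunOn_mem (hbij.surjOn (hCH hζ))
  · intro z hz hzK
    have hwz : w z ∉ C := by
      intro h
      exact hzK ⟨w z, h, hbij.injOn.leftInvOn_invFunOn hz⟩
    have hlt : c * ‖w z - conj b‖ < ‖w z - b‖ := lt_of_not_ge hwz
    have hpos : 0 < ‖w z - b‖ := lt_of_le_of_lt (by positivity) hlt
    have hpos' : 0 < ‖w z - conj b‖ := by
      rw [norm_pos_iff, sub_ne_zero]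
      intro h
      have h1 : 0 < (w z).im := hbij.mapsTo hz
      rw [h, conj_im] at h1
      linarith
    have hratio : ‖w z - conj b‖ / ‖w z - b‖ < c⁻¹ := by
      rw [div_lt_iff₀ hpos, ← div_eq_inv_mul, lt_div_iff₀ hc0, mul_comm]
      exact hlt
    have hlog : Real.log (‖w z - conj b‖ / ‖w z - b‖) < 2 * Real.pi * ε := by
      have := Real.log_lt_log (div_pos hpos' hpos) hratio
      rwa [Real.log_inv, hc, Real.log_exp, neg_neg] at this
    rw [inv_mul_lt_iff₀ (by positivity)]
    exact hlog

/-! ### The Green potential `f = g + (2π)⁻¹ log ‖· - u‖` is harmonic -/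

/-- The difference quotient `dslope w u` of an injective holomorphic `w` on the open set `Ω ∋ u`
does not vanish on `Ω` (injectivity off `u`, `w′(u) ≠ 0` at `u`). [folklore] -/
theorem dslope_ne_zero_of_injOn {Ω : Set ℂ} (hΩ : IsOpen Ω) {w : ℂ → ℂ}
    (hw : DifferentiableOn ℂ w Ω) (hinj : InjOn w Ω) {u : ℂ} (hu : u ∈ Ω) {z : ℂ} (hz : z ∈ Ω) :
    dslope w u z ≠ 0 := by
  by_cases hzu : z = u
  · subst hzu
    rw [dslope_same]
    exact Literature.Analysis.Complex.SCV.deriv_ne_zero_of_injOn hw hΩ hinj hz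
  · rw [dslope_of_ne _ hzu, slope_def_field, div_ne_zero_iff]
    exact ⟨sub_ne_zero.2 fun h => hzu (hinj hz hu h), sub_ne_zero.2 hzu⟩

/-- **The Green potential is harmonic.** With `b = w u`, the function
`f(z) = (2π)⁻¹ log ‖(w z - conj b) / dslope w u z‖` is harmonic on `Ω` (the argument of the
logarithm is holomorphic and zero-free on `Ω`: `im (w z) > 0 > im (conj b)`, and
`dslope_ne_zero_of_injOn`). [folklore] -/
theorem harmonicOnNhd_greenPotential {Ω : Set ℂ} (hΩ : IsOpen Ω) {w : ℂ → ℂ}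
    (hw : DifferentiableOn ℂ w Ω) (hbij : BijOn w Ω {z : ℂ | 0 < z.im}) {u : ℂ} (hu : u ∈ Ω) :
    HarmonicOnNhd (fun z => (2 * Real.pi)⁻¹ * Real.log ‖(w z - conj (w u)) / dslope w u z‖) Ω := by
  intro z hz
  have hΩz : Ω ∈ 𝓝 z := hΩ.mem_nhds hz
  have hd : DifferentiableOn ℂ (dslope w u) Ω := (differentiableOn_dslope (hΩ.mem_nhds hu)).2 hw
  have han : AnalyticAt ℂ (fun z => (w z - conj (w u)) / dslope w u z) z := by
    refine ((hw.analyticAt hΩz).sub analyticAt_const).div (hd.analyticAt hΩz) ?_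
    exact dslope_ne_zero_of_injOn hΩ hw hbij.injOn hu hz
  have hne : (fun z => (w z - conj (w u)) / dslope w u z) z ≠ 0 := by
    simp only [ne_eq, div_eq_zero_iff, not_or]
    refine ⟨sub_ne_zero.2 fun h => ?_, dslope_ne_zero_of_injOn hΩ hw hbij.injOn hu hz⟩
    have h1 : 0 < (w z).im := hbij.mapsTo hz
    have h2 : 0 < (w u).im := hbij.mapsTo hu
    rw [h, conj_im] at h1
    linarith
  have key := (han.harmonicAt_log_norm hne).const_smul (c := (2 * Real.pi)⁻¹)
  have hfun : ((2 * Real.pi)⁻¹ • fun x => Real.log ‖(w x - conj (w u)) / dslope w u x‖) =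
      fun z => (2 * Real.pi)⁻¹ * Real.log ‖(w z - conj (w u)) / dslope w u z‖ := by
    funext z; simp [smul_eq_mul]
  rw [hfun] at key
  exact key

/-- Off the pole the Green potential is the Green function plus the logarithmic potential:
`(2π)⁻¹ log ‖(w z - conj b)/dslope w u z‖ = (2π)⁻¹ log(‖w z - conj b‖/‖w z - b‖) + (2π)⁻¹ log ‖z - u‖`
for `z ∈ Ω`, `z ≠ u`. [folklore] -/
theorem greenPotential_eq {Ω : Set ℂ} {w : ℂ → ℂ} (hbij : BijOn w Ω {z : ℂ | 0 < z.im})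
    {u : ℂ} (hu : u ∈ Ω) {z : ℂ} (hz : z ∈ Ω) (hzu : z ≠ u) :
    (2 * Real.pi)⁻¹ * Real.log ‖(w z - conj (w u)) / dslope w u z‖ =
      (2 * Real.pi)⁻¹ * Real.log (‖w z - conj (w u)‖ / ‖w z - w u‖) +
        (2 * Real.pi)⁻¹ * Real.log ‖z - u‖ := by
  have hwz : w z - w u ≠ 0 := sub_ne_zero.2 fun h => hzu (hbij.injOn hz hu h)
  have hzu' : z - u ≠ 0 := sub_ne_zero.2 hzu
  have hconj : w z - conj (w u) ≠ 0 := by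
    refine sub_ne_zero.2 fun h => ?_
    have h1 : 0 < (w z).im := hbij.mapsTo hz
    have h2 : 0 < (w u).im := hbij.mapsTo hu
    rw [h, conj_im] at h1
    linarith
  rw [dslope_of_ne _ hzu, slope_def_field, div_div_eq_mul_div, norm_div, norm_mul,
    ← mul_add, Real.log_div (mul_ne_zero (norm_ne_zero_iff.2 hconj) (norm_ne_zero_iff.2 hzu'))
      (norm_ne_zero_iff.2 hwz), Real.log_mul (norm_ne_zero_iff.2 hconj) (norm_ne_zero_iff.2 hzu'),
    Real.log_div (norm_ne_zero_iff.2 hconj) (norm_ne_zero_iff.2 hwz)]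
  ring

/-! ### Boundary behaviour of the conformal map at points where it extends holomorphically -/

/-- **The conformal map is real on the boundary.** If `w` is holomorphic on an open set `U ⊇ Ω`
(`Ω` open) and maps `Ω` bijectively onto `ℍ`, then `im (w ζ) = 0` at every `ζ ∈ frontier Ω ∩ U`:
`w ζ ∈ closure ℍ`, and `im (w ζ) > 0` would give `w ζ = w y` with `y ∈ Ω`, contradicting
injectivity near `ζ` by the open mapping theorem at `y`. [folklore] -/
theorem im_eq_zero_of_mem_frontier {Ω U : Set ℂ} (hΩ : IsOpen Ω) (hU : IsOpen U) (hΩU : Ω ⊆ U)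
    {w : ℂ → ℂ} (hw : DifferentiableOn ℂ w U) (hbij : BijOn w Ω {z : ℂ | 0 < z.im})
    {ζ : ℂ} (hζ : ζ ∈ frontier Ω) (hζU : ζ ∈ U) : (w ζ).im = 0 := by
  have hcont : ContinuousAt w ζ := (hw.differentiableAt (hU.mem_nhds hζU)).continuousAt
  have hζcl : ζ ∈ closure Ω := frontier_subset_closure hζ
  have hζΩ : ζ ∉ Ω := fun h => by
    rw [frontier, hΩ.interior_eq] at hζ
    exact hζ.2 h
  -- `im (w ζ) ≥ 0`
  have hge : 0 ≤ (w ζ).im := by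
    haveI : (𝓝[Ω] ζ).NeBot := mem_closure_iff_nhdsWithin_neBot.1 hζcl
    have hmem : w ζ ∈ closure {z : ℂ | 0 < z.im} :=
      mem_closure_of_tendsto (hcont.tendsto.mono_left (nhdsWithin_le_nhds (s := Ω)))
        (eventually_nhdsWithin_of_forall fun z hz => hbij.mapsTo hz)
    rw [closure_setOf_lt_im] at hmem
    exact hmem
  by_contra hne
  have hpos : 0 < (w ζ).im := lt_of_le_of_ne hge (Ne.symm hne)
  obtain ⟨y, hy, hwy⟩ := hbij.surjOn hpos
  have hyζ : y ≠ ζ := fun h => hζΩ (h ▸ hy)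
  -- disjoint balls around `ζ` and `y`
  obtain ⟨ρ, hρ, hρΩ⟩ := Metric.isOpen_iff.1 hΩ y hy
  set r : ℝ := min ρ (dist y ζ / 2) with hr
  have hr0 : 0 < r := lt_min hρ (by have := dist_pos.2 hyζ; linarith)
  have hBy : ball y r ⊆ Ω := (ball_subset_ball (min_le_left _ _)).trans hρΩ
  have hopen : IsOpen (w '' ball y r) :=
    Literature.Analysis.Complex.SCV.isOpen_image_of_injOn rfl ((hw.mono hΩU).mono hBy) isOpen_ball
      (hbij.injOn.mono hBy)
  have hmem : w '' ball y r ∈ 𝓝 (w ζ) := hopen.mem_nhds ⟨y, mem_ball_self hr0, hwy⟩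
  have hpre : w ⁻¹' (w '' ball y r) ∈ 𝓝 ζ := hcont.preimage_mem_nhds hmem
  -- a point of `Ω` near `ζ` is mapped into `w (ball y r)`
  obtain ⟨z, hzN, hzΩ⟩ : (w ⁻¹' (w '' ball y r) ∩ ball ζ r ∩ Ω).Nonempty :=
    mem_closure_iff_nhds.1 hζcl _ (inter_mem hpre (ball_mem_nhds ζ hr0))
  obtain ⟨y', hy', hwy'⟩ := hzN.1
  have hzy' : z = y' := hbij.injOn hzΩ (hBy hy') hwy'.symm
  have h1 : dist z ζ < r := mem_ball.1 hzN.2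
  have h2 : dist y' y < r := mem_ball.1 hy'
  rw [← hzy'] at h2
  have h3 : dist y ζ ≤ dist y z + dist z ζ := dist_triangle _ _ _
  rw [dist_comm y z] at h3
  have h4 : r ≤ dist y ζ / 2 := min_le_right _ _
  linarith

/-- If `w` is complex-differentiable at `x` and `w (x + t)` is real for all small real `t > 0`,
then `w x` and `deriv w x` are real. [folklore] -/
theorem im_deriv_eq_zero_of_real_on_segment {w : ℂ → ℂ} {x : ℂ} (hw : DifferentiableAt ℂ w x)
    {r : ℝ} (hr : 0 < r) (hreal : ∀ t : ℝ, 0 < t → t < r → (w (x + t)).im = 0) :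
    (w x).im = 0 ∧ (deriv w x).im = 0 := by
  have hd : HasDerivAt (fun t : ℝ => w (x + t)) (deriv w x) 0 := by
    have h1 : HasDerivAt (fun ζ : ℂ => w (x + ζ)) (deriv w x) ((0 : ℝ) : ℂ) := by
      rw [ofReal_zero]
      exact HasDerivAt.comp_const_add x 0 (by rw [add_zero]; exact hw.hasDerivAt)
    exact h1.comp_ofReal
  have hev : ∀ᶠ t : ℝ in 𝓝[>] 0, (w (x + t)).im = 0 := by
    filter_upwards [Ioo_mem_nhdsGT hr] with t ht
    exact hreal t ht.1 ht.2
  -- `w x` is real: limit of real values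
  have hcont : Tendsto (fun t : ℝ => (w (x + t)).im) (𝓝[>] 0) (𝓝 (w x).im) := by
    have := (continuous_im.continuousAt.tendsto.comp hd.continuousAt.tendsto)
    simp only [Function.comp_def, ofReal_zero, add_zero] at this
    exact this.mono_left nhdsWithin_le_nhds
  have hx0 : (w x).im = 0 := tendsto_nhds_unique hcont (tendsto_nhds_of_eventually_eq hev)
  refine ⟨hx0, ?_⟩
  -- the difference quotients along real `t > 0` are real
  have hslope := hd.tendsto_slope_zero_right
  simp only [zero_add, ofReal_zero, add_zero] at hslope
  have him := (continuous_im.continuousAt.tendsto.comp hslope)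
  have hzero : ∀ᶠ t : ℝ in 𝓝[>] 0, ((fun t : ℝ => t⁻¹ • (w (x + t) - w x)) t).im = 0 := by
    filter_upwards [hev] with t ht
    simp only [Complex.real_smul, mul_im, ofReal_re, ofReal_im, sub_im, ht, hx0, sub_zero,
      mul_zero, zero_mul, add_zero]
  exact tendsto_nhds_unique him (tendsto_nhds_of_eventually_eq hzero)

/-! ### The normal derivative of the Green function at a flat boundary point -/

/-- **Derivative of the Green function along the inward normal.** Let `w` be complex
differentiable at `x` with `w x` and `deriv w x` real, and `im b > 0`. Then
`s ↦ (2π)⁻¹ log (‖w (x + s i) - conj b‖ / ‖w (x + s i) - b‖)` (which vanishes at `s = 0`) has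
derivative `π⁻¹ · im b · re (deriv w x) / ‖b - w x‖²` at `s = 0`. [folklore] -/
theorem hasDerivAt_green_normal {w : ℂ → ℂ} {x : ℂ} (hw : DifferentiableAt ℂ w x)
    (hx : (w x).im = 0) (hdx : (deriv w x).im = 0) {b : ℂ} (hb : 0 < b.im) :
    HasDerivAt (fun s : ℝ => (2 * Real.pi)⁻¹ * Real.log (‖w (x + s * I) - conj b‖ / ‖w (x + s * I) - b‖))
      (Real.pi⁻¹ * (b.im * (deriv w x).re / ‖b - w x‖ ^ 2)) 0 := by
  -- the path `s ↦ w (x + s i)` and its derivative `w′(x) i`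
  have hγ : HasDerivAt (fun s : ℝ => w (x + s * I)) (deriv w x * I) 0 := by
    have h1 : HasDerivAt (fun ζ : ℂ => x + ζ * I) I ((0 : ℝ) : ℂ) := by
      simpa using ((hasDerivAt_id (((0 : ℝ) : ℂ))).mul_const I).const_add x
    have h2 : HasDerivAt w (deriv w x) (x + ((0 : ℝ) : ℂ) * I) := by
      simpa using hw.hasDerivAt
    have h3 := h2.comp (((0 : ℝ) : ℂ)) h1
    exact h3.comp_ofReal
  -- squared distances to `conj b` and `b`
  have hN1 : HasDerivAt (fun s : ℝ => ‖w (x + s * I) - conj b‖ ^ 2)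
      (2 * inner ℝ (w x - conj b) (deriv w x * I)) 0 := by
    have := (hγ.sub_const (conj b)).norm_sq
    simpa using this
  have hN2 : HasDerivAt (fun s : ℝ => ‖w (x + s * I) - b‖ ^ 2)
      (2 * inner ℝ (w x - b) (deriv w x * I)) 0 := by
    have := (hγ.sub_const b).norm_sq
    simpa using this
  -- the inner products
  have hi1 : inner ℝ (w x - conj b) (deriv w x * I) = (deriv w x).re * b.im := by
    rw [Complex.inner]
    simp only [map_sub, Complex.conj_conj, mul_re, sub_re, sub_im, mul_im, I_re, I_im, conj_re,
      conj_im, hx, hdx]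
    ring
  have hi2 : inner ℝ (w x - b) (deriv w x * I) = -((deriv w x).re * b.im) := by
    rw [Complex.inner]
    simp only [map_sub, mul_re, sub_re, sub_im, mul_im, I_re, I_im, conj_re, conj_im, hx, hdx]
    ring
  rw [hi1] at hN1
  rw [hi2] at hN2
  -- values at `s = 0`
  set q : ℝ := ‖b - w x‖ ^ 2 with hq
  have hq1 : ‖w x - conj b‖ ^ 2 = q := by
    rw [hq, ← normSq_eq_norm_sq, ← normSq_eq_norm_sq, ← normSq_neg (b - w x), neg_sub]
    have := normSq_sub_conj_sub (w x) b
    rw [hx] at this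
    linarith
  have hq2 : ‖w x - b‖ ^ 2 = q := by rw [hq, ← norm_neg, neg_sub]
  have hqpos : 0 < q := by
    rw [hq]
    refine pow_pos (norm_pos_iff.2 (sub_ne_zero.2 fun h => ?_)) 2
    rw [h] at hb; rw [hx] at hb; exact lt_irrefl _ hb
  -- logarithms
  have hL1 := hN1.log (by simp only [ofReal_zero, zero_mul, add_zero]; rw [hq1]; exact hqpos.ne')
  have hL2 := hN2.log (by simp only [ofReal_zero, zero_mul, add_zero]; rw [hq2]; exact hqpos.ne')
  simp only [ofReal_zero, zero_mul, add_zero] at hL1 hL2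
  rw [hq1] at hL1
  rw [hq2] at hL2
  have hL := (hL1.sub hL2).const_mul (4 * Real.pi)⁻¹
  -- identify the function near `0` and the value of the derivative
  have hfun : (fun s : ℝ => (2 * Real.pi)⁻¹ * Real.log (‖w (x + s * I) - conj b‖ / ‖w (x + s * I) - b‖))
      =ᶠ[𝓝 0] fun s => (4 * Real.pi)⁻¹ *
        (Real.log (‖w (x + s * I) - conj b‖ ^ 2) - Real.log (‖w (x + s * I) - b‖ ^ 2)) := by
    -- near `0` both norms are nonzero
    have hc1 : ContinuousAt (fun s : ℝ => ‖w (x + s * I) - conj b‖) 0 :=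
      (hγ.continuousAt.sub continuousAt_const).norm
    have hc2 : ContinuousAt (fun s : ℝ => ‖w (x + s * I) - b‖) 0 :=
      (hγ.continuousAt.sub continuousAt_const).norm
    have hv1 : (fun s : ℝ => ‖w (x + s * I) - conj b‖) 0 ≠ 0 := by
      simp only [ofReal_zero, zero_mul, add_zero]
      intro h; rw [h] at hq1; simp at hq1; exact hqpos.ne' hq1.symm
    have hv2 : (fun s : ℝ => ‖w (x + s * I) - b‖) 0 ≠ 0 := by
      simp only [ofReal_zero, zero_mul, add_zero]
      intro h; rw [h] at hq2; simp at hq2; exact hqpos.ne' hq2.symm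
    filter_upwards [hc1.eventually_ne hv1, hc2.eventually_ne hv2] with s hs1 hs2
    rw [Real.log_div hs1 hs2, Real.log_pow, Real.log_pow]
    push_cast
    ring
  have hq0 : q ≠ 0 := hqpos.ne'
  refine (hL.congr_of_eventuallyEq hfun).congr_deriv ?_
  field_simp
  ring

/-- **The normal derivative limit.** Under the hypotheses of `hasDerivAt_green_normal`,
`g(x + i s)/s → π⁻¹ im b · re (w′(x)) / ‖b - w x‖²` as `s → 0`, `s ≠ 0`, where
`g = (2π)⁻¹ log (‖w - conj b‖/‖w - b‖)`; this is the value
`-∂_{x₂} g(v₁, (x₁, 0)) = π⁻¹ im w(v₁) |w′(x)| / |w(v₁) - w(x)|²` of Kenyon 2000, Thm 14 / §6.1, when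
`re w′(x) = |w′(x)|`. [cite: Kenyon2000, Thm 14 and §6.1] -/
theorem tendsto_green_div {w : ℂ → ℂ} {x : ℂ} (hw : DifferentiableAt ℂ w x)
    (hx : (w x).im = 0) (hdx : (deriv w x).im = 0) {b : ℂ} (hb : 0 < b.im) :
    Tendsto (fun s : ℝ => (2 * Real.pi)⁻¹ *
        Real.log (‖w (x + s * I) - conj b‖ / ‖w (x + s * I) - b‖) / s) (𝓝[≠] 0)
      (𝓝 (Real.pi⁻¹ * (b.im * (deriv w x).re / ‖b - w x‖ ^ 2))) := by
  have h := (hasDerivAt_green_normal hw hx hdx hb).tendsto_slope_zero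
  have h0 : (2 * Real.pi)⁻¹ * Real.log (‖w (x + ((0 : ℝ) : ℂ) * I) - conj b‖ / ‖w (x + ((0 : ℝ) : ℂ) * I) - b‖) = 0 := by
    simp only [ofReal_zero, zero_mul, add_zero]
    have h1 : ‖w x - conj b‖ = ‖w x - b‖ := by
      have e1 : normSq (w x - conj b) = normSq (w x - b) := by
        have := normSq_sub_conj_sub (w x) b; rw [hx] at this; linarith
      rw [← Real.sqrt_sq (norm_nonneg (w x - conj b)), ← Real.sqrt_sq (norm_nonneg (w x - b)),
        ← normSq_eq_norm_sq, ← normSq_eq_norm_sq, e1]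
    rw [h1]
    by_cases hz : ‖w x - b‖ = 0
    · rw [hz, div_zero, Real.log_zero, mul_zero]
    · rw [div_self hz, Real.log_one, mul_zero]
  refine h.congr' (Eventually.of_forall fun s => ?_)
  simp only [zero_add, h0, sub_zero, smul_eq_mul]
  exact inv_mul_eq_div _ _

end Literature.Probability.RandomPlanarGeometry
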